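import Summits.Ventures.PercRepro.Lemma6
import Summits.Ventures.PercRepro.PendantLemma6

/-!
# `Lemma6Pendant` (typer-2's typed target) from `pendant_lemma6`

The rows of `G.law4 p v b c d` (order `rgs4`) are identified with the cell events of
`PendantLemma6.lean`: `x_i = P(F_i ∩ J_i)`, `R_i = P(F_i ∩ J_iᶜ)`, `Y_i = P(D_i ∩ J_iᶜ)` (a disjoint
union of four rows) and `⊤ = P(D_i ∩ J_i)`; then `Lemma6Pendant_holds` is three applications of
`pendant_lemma6`, and `PendantFiveA` follows by typer-2's `PendantFiveA_of_Lemma6Pendant`.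
-/

namespace PercRepro

open Finset

namespace MultiGraph

variable {V E : Type*} (G : MultiGraph V E)

/-- Membership in a partition row of four marks, by the six unordered pairs. -/
theorem mem_partitionEvent4_iff (v b c d : V) (rgs : Fin 4 → ℕ) (ω : Config E) :
    ω ∈ G.partitionEvent ![v, b, c, d] rgs ↔
      (G.Conn ω v b ↔ rgs 0 = rgs 1) ∧ (G.Conn ω v c ↔ rgs 0 = rgs 2) ∧
        (G.Conn ω v d ↔ rgs 0 = rgs 3) ∧ (G.Conn ω b c ↔ rgs 1 = rgs 2) ∧
        (G.Conn ω b d ↔ rgs 1 = rgs 3) ∧ (G.Conn ω c d ↔ rgs 2 = rgs 3) := by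
  simp only [partitionEvent, Set.mem_setOf_eq]
  constructor
  · intro h
    exact ⟨h 0 1, h 0 2, h 0 3, h 1 2, h 1 3, h 2 3⟩
  · rintro ⟨h01, h02, h03, h12, h13, h23⟩ i j
    have sym : ∀ {x y : V} {m n : ℕ}, (G.Conn ω x y ↔ m = n) → (G.Conn ω y x ↔ n = m) :=
      fun h => conn_comm.trans (h.trans eq_comm)
    have refl : ∀ {x : V} {m : ℕ}, G.Conn ω x x ↔ m = m :=
      fun {x m} => iff_of_true (Conn.refl G ω x) rfl
    fin_cases i <;> fin_cases j
    all_goals first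
      | exact refl | exact h01 | exact h02 | exact h03 | exact h12 | exact h13 | exact h23
      | exact sym h01 | exact sym h02 | exact sym h03 | exact sym h12 | exact sym h13
      | exact sym h23

/-- Transitivity among four marks, in the six sorted atoms. -/
theorem conn_triples (ω : Config E) (v b c d : V) :
    (G.Conn ω v b → G.Conn ω b c → G.Conn ω v c) ∧ (G.Conn ω v b → G.Conn ω v c → G.Conn ω b c) ∧
      (G.Conn ω v c → G.Conn ω b c → G.Conn ω v b) ∧
    (G.Conn ω v b → G.Conn ω b d → G.Conn ω v d) ∧ (G.Conn ω v b → G.Conn ω v d → G.Conn ω b d) ∧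
      (G.Conn ω v d → G.Conn ω b d → G.Conn ω v b) ∧
    (G.Conn ω v c → G.Conn ω c d → G.Conn ω v d) ∧ (G.Conn ω v c → G.Conn ω v d → G.Conn ω c d) ∧
      (G.Conn ω v d → G.Conn ω c d → G.Conn ω v c) ∧
    (G.Conn ω b c → G.Conn ω c d → G.Conn ω b d) ∧ (G.Conn ω b c → G.Conn ω b d → G.Conn ω c d) ∧
      (G.Conn ω b d → G.Conn ω c d → G.Conn ω b c) :=
  ⟨fun h1 h2 => h1.trans h2, fun h1 h2 => h1.symm.trans h2, fun h1 h2 => h1.trans h2.symm,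
   fun h1 h2 => h1.trans h2, fun h1 h2 => h1.symm.trans h2, fun h1 h2 => h1.trans h2.symm,
   fun h1 h2 => h1.trans h2, fun h1 h2 => h1.symm.trans h2, fun h1 h2 => h1.trans h2.symm,
   fun h1 h2 => h1.trans h2, fun h1 h2 => h1.symm.trans h2, fun h1 h2 => h1.trans h2.symm⟩

/-- Row `vbcd` is `D_b ∩ J_b`. -/
theorem row0_eq_b (v b c d : V) :
    G.partitionEvent ![v, b, c, d] (rgs4 0) = G.attachEvent v b c d ∩ G.connEvent c d := by
  ext ω
  simp only [G.mem_partitionEvent4_iff]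
  rw [show rgs4 0 = ![0, 0, 0, 0] from rfl]
  simp only [attachEvent, connEvent, Set.mem_inter_iff, Set.mem_union, Set.mem_setOf_eq, Matrix.cons_val_zero, Matrix.cons_val_one, Matrix.head_cons, Matrix.cons_val_two, Matrix.tail_cons, Matrix.cons_val_three]
  norm_num
  obtain ⟨t1, t2, t3, t4, t5, t6, t7, t8, t9, t10, t11, t12⟩ := G.conn_triples ω v b c d
  constructor
  · rintro ⟨-, h2, -, h4, -, h6⟩
    exact ⟨⟨Or.inl h2, Or.inl h4⟩, h6⟩
  · rintro ⟨⟨hv, hb⟩, h6⟩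
    have hvc : G.Conn ω v c := hv.elim id fun hvd => t9 hvd h6
    have hbc : G.Conn ω b c := hb.elim id fun hbd => t12 hbd h6
    exact ⟨t3 hvc hbc, hvc, t7 hvc h6, hbc, t10 hbc h6, h6⟩

/-- Row `vbcd` is `D_c ∩ J_c`. -/
theorem row0_eq_c (v b c d : V) :
    G.partitionEvent ![v, b, c, d] (rgs4 0) = G.attachEvent v c b d ∩ G.connEvent b d := by
  ext ω
  simp only [G.mem_partitionEvent4_iff]
  rw [show rgs4 0 = ![0, 0, 0, 0] from rfl]
  simp only [attachEvent, connEvent, Set.mem_inter_iff, Set.mem_union, Set.mem_setOf_eq, Matrix.cons_val_zero, Matrix.cons_val_one, Matrix.head_cons, Matrix.cons_val_two, Matrix.tail_cons, Matrix.cons_val_three]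
  norm_num
  rw [show G.Conn ω c b ↔ G.Conn ω b c from conn_comm]
  obtain ⟨t1, t2, t3, t4, t5, t6, t7, t8, t9, t10, t11, t12⟩ := G.conn_triples ω v b c d
  constructor
  · rintro ⟨h1, -, -, h4, h5, -⟩
    exact ⟨⟨Or.inl h1, Or.inl h4⟩, h5⟩
  · rintro ⟨⟨hv, hc⟩, h5⟩
    have hvb : G.Conn ω v b := hv.elim id fun hvd => t6 hvd h5
    have hbc : G.Conn ω b c := hc.elim id fun hcd => t12 h5 hcd
    exact ⟨hvb, t1 hvb hbc, t4 hvb h5, hbc, h5, t11 hbc h5⟩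

/-- Row `vbcd` is `D_d ∩ J_d`. -/
theorem row0_eq_d (v b c d : V) :
    G.partitionEvent ![v, b, c, d] (rgs4 0) = G.attachEvent v d b c ∩ G.connEvent b c := by
  ext ω
  simp only [G.mem_partitionEvent4_iff]
  rw [show rgs4 0 = ![0, 0, 0, 0] from rfl]
  simp only [attachEvent, connEvent, Set.mem_inter_iff, Set.mem_union, Set.mem_setOf_eq, Matrix.cons_val_zero, Matrix.cons_val_one, Matrix.head_cons, Matrix.cons_val_two, Matrix.tail_cons, Matrix.cons_val_three]
  norm_num
  rw [show G.Conn ω d b ↔ G.Conn ω b d from conn_comm]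
  rw [show G.Conn ω d c ↔ G.Conn ω c d from conn_comm]
  obtain ⟨t1, t2, t3, t4, t5, t6, t7, t8, t9, t10, t11, t12⟩ := G.conn_triples ω v b c d
  constructor
  · rintro ⟨h1, -, -, h4, h5, -⟩
    exact ⟨⟨Or.inl h1, Or.inl h5⟩, h4⟩
  · rintro ⟨⟨hv, hd⟩, h4⟩
    have hvb : G.Conn ω v b := hv.elim id fun hvc => t3 hvc h4
    have hbd : G.Conn ω b d := hd.elim id fun hcd => t10 h4 hcd
    exact ⟨hvb, t1 hvb h4, t4 hvb hbd, h4, hbd, t11 h4 hbd⟩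

/-- Row `vb|cd` is `F_b ∩ J_b` (`x_b`). -/
theorem row3_eq (v b c d : V) :
    G.partitionEvent ![v, b, c, d] (rgs4 3) = G.pairEvent v b c d ∩ G.connEvent c d := by
  ext ω
  simp only [G.mem_partitionEvent4_iff]
  rw [show rgs4 3 = ![0, 0, 1, 1] from rfl]
  simp only [pairEvent, connEvent, sepEvent, Set.mem_inter_iff, Set.mem_compl_iff, Set.mem_setOf_eq, Matrix.cons_val_zero, Matrix.cons_val_one, Matrix.head_cons, Matrix.cons_val_two, Matrix.tail_cons, Matrix.cons_val_three]
  norm_num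
  obtain ⟨t1, t2, t3, t4, t5, t6, t7, t8, t9, t10, t11, t12⟩ := G.conn_triples ω v b c d
  constructor
  · rintro ⟨h1, h2, h3, -, -, h6⟩
    exact ⟨⟨⟨h1, h2⟩, h3⟩, h6⟩
  · rintro ⟨⟨⟨h1, h2⟩, h3⟩, h6⟩
    exact ⟨h1, h2, h3, fun h => h2 (t1 h1 h), fun h => h3 (t4 h1 h), h6⟩

/-- Row `vb|c|d` is `F_b ∩ J_bᶜ` (`R_b`). -/
theorem row4_eq (v b c d : V) :
    G.partitionEvent ![v, b, c, d] (rgs4 4) = G.pairEvent v b c d ∩ G.sepEvent c d := by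
  ext ω
  simp only [G.mem_partitionEvent4_iff]
  rw [show rgs4 4 = ![0, 0, 1, 2] from rfl]
  simp only [pairEvent, connEvent, sepEvent, Set.mem_inter_iff, Set.mem_compl_iff, Set.mem_setOf_eq, Matrix.cons_val_zero, Matrix.cons_val_one, Matrix.head_cons, Matrix.cons_val_two, Matrix.tail_cons, Matrix.cons_val_three]
  norm_num
  obtain ⟨t1, t2, t3, t4, t5, t6, t7, t8, t9, t10, t11, t12⟩ := G.conn_triples ω v b c d
  constructor
  · rintro ⟨h1, h2, h3, -, -, h6⟩
    exact ⟨⟨⟨h1, h2⟩, h3⟩, h6⟩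
  · rintro ⟨⟨⟨h1, h2⟩, h3⟩, h6⟩
    exact ⟨h1, h2, h3, fun h => h2 (t1 h1 h), fun h => h3 (t4 h1 h), h6⟩

/-- Row `vc|bd` is `F_c ∩ J_c` (`x_c`). -/
theorem row6_eq (v b c d : V) :
    G.partitionEvent ![v, b, c, d] (rgs4 6) = G.pairEvent v c b d ∩ G.connEvent b d := by
  ext ω
  simp only [G.mem_partitionEvent4_iff]
  rw [show rgs4 6 = ![0, 1, 0, 1] from rfl]
  simp only [pairEvent, connEvent, sepEvent, Set.mem_inter_iff, Set.mem_compl_iff, Set.mem_setOf_eq, Matrix.cons_val_zero, Matrix.cons_val_one, Matrix.head_cons, Matrix.cons_val_two, Matrix.tail_cons, Matrix.cons_val_three]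
  norm_num
  obtain ⟨t1, t2, t3, t4, t5, t6, t7, t8, t9, t10, t11, t12⟩ := G.conn_triples ω v b c d
  constructor
  · rintro ⟨h1, h2, h3, -, h5, -⟩
    exact ⟨⟨⟨h2, h1⟩, h3⟩, h5⟩
  · rintro ⟨⟨⟨h2, h1⟩, h3⟩, h5⟩
    exact ⟨h1, h2, h3, fun h => h1 (t3 h2 h), h5, fun h => h3 (t7 h2 h)⟩

/-- Row `vc|b|d` is `F_c ∩ J_cᶜ` (`R_c`). -/
theorem row7_eq (v b c d : V) :
    G.partitionEvent ![v, b, c, d] (rgs4 7) = G.pairEvent v c b d ∩ G.sepEvent b d := by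
  ext ω
  simp only [G.mem_partitionEvent4_iff]
  rw [show rgs4 7 = ![0, 1, 0, 2] from rfl]
  simp only [pairEvent, connEvent, sepEvent, Set.mem_inter_iff, Set.mem_compl_iff, Set.mem_setOf_eq, Matrix.cons_val_zero, Matrix.cons_val_one, Matrix.head_cons, Matrix.cons_val_two, Matrix.tail_cons, Matrix.cons_val_three]
  norm_num
  obtain ⟨t1, t2, t3, t4, t5, t6, t7, t8, t9, t10, t11, t12⟩ := G.conn_triples ω v b c d
  constructor
  · rintro ⟨h1, h2, h3, -, h5, -⟩
    exact ⟨⟨⟨h2, h1⟩, h3⟩, h5⟩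
  · rintro ⟨⟨⟨h2, h1⟩, h3⟩, h5⟩
    exact ⟨h1, h2, h3, fun h => h1 (t3 h2 h), h5, fun h => h3 (t7 h2 h)⟩

/-- Row `vd|bc` is `F_d ∩ J_d` (`x_d`). -/
theorem row8_eq (v b c d : V) :
    G.partitionEvent ![v, b, c, d] (rgs4 8) = G.pairEvent v d b c ∩ G.connEvent b c := by
  ext ω
  simp only [G.mem_partitionEvent4_iff]
  rw [show rgs4 8 = ![0, 1, 1, 0] from rfl]
  simp only [pairEvent, connEvent, sepEvent, Set.mem_inter_iff, Set.mem_compl_iff, Set.mem_setOf_eq, Matrix.cons_val_zero, Matrix.cons_val_one, Matrix.head_cons, Matrix.cons_val_two, Matrix.tail_cons, Matrix.cons_val_three]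
  norm_num
  obtain ⟨t1, t2, t3, t4, t5, t6, t7, t8, t9, t10, t11, t12⟩ := G.conn_triples ω v b c d
  constructor
  · rintro ⟨h1, h2, h3, h4, -, -⟩
    exact ⟨⟨⟨h3, h1⟩, h2⟩, h4⟩
  · rintro ⟨⟨⟨h3, h1⟩, h2⟩, h4⟩
    exact ⟨h1, h2, h3, h4, fun h => h1 (t6 h3 h), fun h => h2 (t9 h3 h)⟩

/-- Row `vd|b|c` is `F_d ∩ J_dᶜ` (`R_d`). -/
theorem row11_eq (v b c d : V) :
    G.partitionEvent ![v, b, c, d] (rgs4 11) = G.pairEvent v d b c ∩ G.sepEvent b c := by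
  ext ω
  simp only [G.mem_partitionEvent4_iff]
  rw [show rgs4 11 = ![0, 1, 2, 0] from rfl]
  simp only [pairEvent, connEvent, sepEvent, Set.mem_inter_iff, Set.mem_compl_iff, Set.mem_setOf_eq, Matrix.cons_val_zero, Matrix.cons_val_one, Matrix.head_cons, Matrix.cons_val_two, Matrix.tail_cons, Matrix.cons_val_three]
  norm_num
  obtain ⟨t1, t2, t3, t4, t5, t6, t7, t8, t9, t10, t11, t12⟩ := G.conn_triples ω v b c d
  constructor
  · rintro ⟨h1, h2, h3, h4, -, -⟩
    exact ⟨⟨⟨h3, h1⟩, h2⟩, h4⟩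
  · rintro ⟨⟨⟨h3, h1⟩, h2⟩, h4⟩
    exact ⟨h1, h2, h3, h4, fun h => h1 (t6 h3 h), fun h => h2 (t9 h3 h)⟩

/-- Rows `vbc|d, vbd|c, vc|bd, vd|bc` form `D_b ∩ J_bᶜ` (`Y_b`). -/
theorem rowsY_b (v b c d : V) :
    G.partitionEvent ![v, b, c, d] (rgs4 1) ∪ G.partitionEvent ![v, b, c, d] (rgs4 2) ∪ G.partitionEvent ![v, b, c, d] (rgs4 6) ∪ G.partitionEvent ![v, b, c, d] (rgs4 8) = G.attachEvent v b c d ∩ G.sepEvent c d := by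
  ext ω
  rw [Set.mem_union, Set.mem_union, Set.mem_union]
  simp only [G.mem_partitionEvent4_iff]
  rw [show rgs4 1 = ![0, 0, 0, 1] from rfl]
  rw [show rgs4 2 = ![0, 0, 1, 0] from rfl]
  rw [show rgs4 6 = ![0, 1, 0, 1] from rfl]
  rw [show rgs4 8 = ![0, 1, 1, 0] from rfl]
  simp only [attachEvent, connEvent, sepEvent, Set.mem_inter_iff, Set.mem_union, Set.mem_compl_iff, Set.mem_setOf_eq, Matrix.cons_val_zero, Matrix.cons_val_one, Matrix.head_cons, Matrix.cons_val_two, Matrix.tail_cons, Matrix.cons_val_three]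
  norm_num
  obtain ⟨t1, t2, t3, t4, t5, t6, t7, t8, t9, t10, t11, t12⟩ := G.conn_triples ω v b c d
  constructor
  · rintro (((⟨-, h2, -, h4, -, h6⟩ | ⟨-, -, h3, -, h5, h6⟩) | ⟨-, h2, -, -, h5, h6⟩) |
      ⟨-, -, h3, h4, -, h6⟩)
    · exact ⟨⟨Or.inl h2, Or.inl h4⟩, h6⟩
    · exact ⟨⟨Or.inr h3, Or.inr h5⟩, h6⟩
    · exact ⟨⟨Or.inl h2, Or.inr h5⟩, h6⟩
    · exact ⟨⟨Or.inr h3, Or.inl h4⟩, h6⟩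
  · rintro ⟨⟨hv, hb⟩, hcd⟩
    rcases hv with hvc | hvd <;> rcases hb with hbc | hbd
    · exact Or.inl (Or.inl (Or.inl ⟨t3 hvc hbc, hvc, fun hvd => hcd (t8 hvc hvd), hbc,
        fun hbd => hcd (t11 hbc hbd), hcd⟩))
    · exact Or.inl (Or.inr ⟨fun hvb => hcd (t11 (t2 hvb hvc) hbd), hvc,
        fun hvd => hcd (t8 hvc hvd), fun hbc => hcd (t11 hbc hbd), hbd, hcd⟩)
    · exact Or.inr ⟨fun hvb => hcd (t11 hbc (t5 hvb hvd)), fun hvc => hcd (t8 hvc hvd), hvd,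
        hbc, fun hbd => hcd (t11 hbc hbd), hcd⟩
    · exact Or.inl (Or.inl (Or.inr ⟨t6 hvd hbd, fun hvc => hcd (t8 hvc hvd), hvd,
        fun hbc => hcd (t11 hbc hbd), hbd, hcd⟩))

/-- Rows `vbc|d, vcd|b, vb|cd, vd|bc` form `D_c ∩ J_cᶜ` (`Y_c`). -/
theorem rowsY_c (v b c d : V) :
    G.partitionEvent ![v, b, c, d] (rgs4 1) ∪ G.partitionEvent ![v, b, c, d] (rgs4 5) ∪ G.partitionEvent ![v, b, c, d] (rgs4 3) ∪ G.partitionEvent ![v, b, c, d] (rgs4 8) = G.attachEvent v c b d ∩ G.sepEvent b d := by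
  ext ω
  rw [Set.mem_union, Set.mem_union, Set.mem_union]
  simp only [G.mem_partitionEvent4_iff]
  rw [show rgs4 1 = ![0, 0, 0, 1] from rfl]
  rw [show rgs4 5 = ![0, 1, 0, 0] from rfl]
  rw [show rgs4 3 = ![0, 0, 1, 1] from rfl]
  rw [show rgs4 8 = ![0, 1, 1, 0] from rfl]
  simp only [attachEvent, connEvent, sepEvent, Set.mem_inter_iff, Set.mem_union, Set.mem_compl_iff, Set.mem_setOf_eq, Matrix.cons_val_zero, Matrix.cons_val_one, Matrix.head_cons, Matrix.cons_val_two, Matrix.tail_cons, Matrix.cons_val_three]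
  norm_num
  rw [show G.Conn ω c b ↔ G.Conn ω b c from conn_comm]
  obtain ⟨t1, t2, t3, t4, t5, t6, t7, t8, t9, t10, t11, t12⟩ := G.conn_triples ω v b c d
  constructor
  · rintro (((⟨h1, -, -, h4, h5, -⟩ | ⟨-, -, h3, -, h5, h6⟩) | ⟨h1, -, -, -, h5, h6⟩) |
      ⟨-, -, h3, h4, h5, -⟩)
    · exact ⟨⟨Or.inl h1, Or.inl h4⟩, h5⟩
    · exact ⟨⟨Or.inr h3, Or.inr h6⟩, h5⟩
    · exact ⟨⟨Or.inl h1, Or.inr h6⟩, h5⟩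
    · exact ⟨⟨Or.inr h3, Or.inl h4⟩, h5⟩
  · rintro ⟨⟨hv, hc⟩, hbd⟩
    rcases hv with hvb | hvd <;> rcases hc with hbc | hcd
    · exact Or.inl (Or.inl (Or.inl ⟨hvb, t1 hvb hbc, fun hvd => hbd (t5 hvb hvd), hbc, hbd,
        fun hcd => hbd (t10 hbc hcd)⟩))
    · exact Or.inl (Or.inr ⟨hvb, fun hvc => hbd (t10 (t2 hvb hvc) hcd),
        fun hvd => hbd (t5 hvb hvd), fun hbc => hbd (t10 hbc hcd), hbd, hcd⟩)
    · exact Or.inr ⟨fun hvb => hbd (t5 hvb hvd), fun hvc => hbd (t10 hbc (t8 hvc hvd)), hvd, hbc,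
        hbd, fun hcd => hbd (t10 hbc hcd)⟩
    · exact Or.inl (Or.inl (Or.inr ⟨fun hvb => hbd (t5 hvb hvd), t9 hvd hcd, hvd,
        fun hbc => hbd (t10 hbc hcd), hbd, hcd⟩))

/-- Rows `vbd|c, vcd|b, vb|cd, vc|bd` form `D_d ∩ J_dᶜ` (`Y_d`). -/
theorem rowsY_d (v b c d : V) :
    G.partitionEvent ![v, b, c, d] (rgs4 2) ∪ G.partitionEvent ![v, b, c, d] (rgs4 5) ∪ G.partitionEvent ![v, b, c, d] (rgs4 3) ∪ G.partitionEvent ![v, b, c, d] (rgs4 6) = G.attachEvent v d b c ∩ G.sepEvent b c := by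
  ext ω
  rw [Set.mem_union, Set.mem_union, Set.mem_union]
  simp only [G.mem_partitionEvent4_iff]
  rw [show rgs4 2 = ![0, 0, 1, 0] from rfl]
  rw [show rgs4 5 = ![0, 1, 0, 0] from rfl]
  rw [show rgs4 3 = ![0, 0, 1, 1] from rfl]
  rw [show rgs4 6 = ![0, 1, 0, 1] from rfl]
  simp only [attachEvent, connEvent, sepEvent, Set.mem_inter_iff, Set.mem_union, Set.mem_compl_iff, Set.mem_setOf_eq, Matrix.cons_val_zero, Matrix.cons_val_one, Matrix.head_cons, Matrix.cons_val_two, Matrix.tail_cons, Matrix.cons_val_three]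
  norm_num
  rw [show G.Conn ω d b ↔ G.Conn ω b d from conn_comm]
  rw [show G.Conn ω d c ↔ G.Conn ω c d from conn_comm]
  obtain ⟨t1, t2, t3, t4, t5, t6, t7, t8, t9, t10, t11, t12⟩ := G.conn_triples ω v b c d
  constructor
  · rintro (((⟨h1, -, -, h4, h5, -⟩ | ⟨-, h2, -, h4, -, h6⟩) | ⟨h1, -, -, h4, -, h6⟩) |
      ⟨-, h2, -, h4, h5, -⟩)
    · exact ⟨⟨Or.inl h1, Or.inl h5⟩, h4⟩
    · exact ⟨⟨Or.inr h2, Or.inr h6⟩, h4⟩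
    · exact ⟨⟨Or.inl h1, Or.inr h6⟩, h4⟩
    · exact ⟨⟨Or.inr h2, Or.inl h5⟩, h4⟩
  · rintro ⟨⟨hv, hd⟩, hbc⟩
    rcases hv with hvb | hvc <;> rcases hd with hbd | hcd
    · exact Or.inl (Or.inl (Or.inl ⟨hvb, fun hvc => hbc (t2 hvb hvc), t4 hvb hbd, hbc, hbd,
        fun hcd => hbc (t12 hbd hcd)⟩))
    · exact Or.inl (Or.inr ⟨hvb, fun hvc => hbc (t2 hvb hvc), fun hvd => hbc (t12 (t5 hvb hvd) hcd),
        hbc, fun hbd => hbc (t12 hbd hcd), hcd⟩)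
    · exact Or.inr ⟨fun hvb => hbc (t2 hvb hvc), hvc, fun hvd => hbc (t12 hbd (t8 hvc hvd)), hbc,
        hbd, fun hcd => hbc (t12 hbd hcd)⟩
    · exact Or.inl (Or.inl (Or.inr ⟨fun hvb => hbc (t2 hvb hvc), hvc, t7 hvc hcd, hbc,
        fun hbd => hbc (t12 hbd hcd), hcd⟩))


/-- Two partition rows whose label patterns differ on some pair are disjoint. -/
theorem disjoint_partitionEvent_of_pattern {k : ℕ} (m : Fin k → V) (rgs rgs' : Fin k → ℕ)
    (i j : Fin k) (h : (rgs i = rgs j ∧ rgs' i ≠ rgs' j) ∨ (rgs i ≠ rgs j ∧ rgs' i = rgs' j)) :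
    Disjoint (G.partitionEvent m rgs) (G.partitionEvent m rgs') := by
  rw [Set.disjoint_left]
  intro ω h1 h2
  have e1 : G.Conn ω (m i) (m j) ↔ rgs i = rgs j := h1 i j
  have e2 : G.Conn ω (m i) (m j) ↔ rgs' i = rgs' j := h2 i j
  rcases h with ⟨ha, hb⟩ | ⟨ha, hb⟩
  · exact hb (e2.1 (e1.2 ha))
  · exact ha (e1.1 (e2.2 hb))

section Prob

variable [Fintype E] [DecidableEq E]

/-- The probability of a union of four pairwise disjoint rows. -/
theorem prob_union4 (p : E → ℝ) {A B C D : Set (Config E)} (hAB : Disjoint A B)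
    (hAC : Disjoint A C) (hBC : Disjoint B C) (hAD : Disjoint A D) (hBD : Disjoint B D)
    (hCD : Disjoint C D) :
    prob p (A ∪ B ∪ C ∪ D) = prob p A + prob p B + prob p C + prob p D := by
  rw [prob_union_of_disjoint p (Set.disjoint_union_left.2 ⟨Set.disjoint_union_left.2 ⟨hAD, hBD⟩, hCD⟩),
    prob_union_of_disjoint p (Set.disjoint_union_left.2 ⟨hAC, hBC⟩), prob_union_of_disjoint p hAB]

/-- `Y_b = P(vbc|d) + P(vbd|c) + P(vc|bd) + P(vd|bc)`. -/
theorem prob_Y_b (p : E → ℝ) (v b c d : V) :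
    prob p (G.attachEvent v b c d ∩ G.sepEvent c d) =
      G.law4 p v b c d 1 + G.law4 p v b c d 2 + G.law4 p v b c d 6 + G.law4 p v b c d 8 := by
  rw [← G.rowsY_b]
  exact prob_union4 p
    (G.disjoint_partitionEvent_of_pattern _ _ _ 0 2 (Or.inl ⟨by decide, by decide⟩))
    (G.disjoint_partitionEvent_of_pattern _ _ _ 0 1 (Or.inl ⟨by decide, by decide⟩))
    (G.disjoint_partitionEvent_of_pattern _ _ _ 0 1 (Or.inl ⟨by decide, by decide⟩))
    (G.disjoint_partitionEvent_of_pattern _ _ _ 0 1 (Or.inl ⟨by decide, by decide⟩))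
    (G.disjoint_partitionEvent_of_pattern _ _ _ 0 1 (Or.inl ⟨by decide, by decide⟩))
    (G.disjoint_partitionEvent_of_pattern _ _ _ 0 2 (Or.inl ⟨by decide, by decide⟩))

/-- `Y_c = P(vbc|d) + P(vcd|b) + P(vb|cd) + P(vd|bc)`. -/
theorem prob_Y_c (p : E → ℝ) (v b c d : V) :
    prob p (G.attachEvent v c b d ∩ G.sepEvent b d) =
      G.law4 p v b c d 1 + G.law4 p v b c d 5 + G.law4 p v b c d 3 + G.law4 p v b c d 8 := by
  rw [← G.rowsY_c]
  exact prob_union4 p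
    (G.disjoint_partitionEvent_of_pattern _ _ _ 0 1 (Or.inl ⟨by decide, by decide⟩))
    (G.disjoint_partitionEvent_of_pattern _ _ _ 0 2 (Or.inl ⟨by decide, by decide⟩))
    (G.disjoint_partitionEvent_of_pattern _ _ _ 0 1 (Or.inr ⟨by decide, by decide⟩))
    (G.disjoint_partitionEvent_of_pattern _ _ _ 0 1 (Or.inl ⟨by decide, by decide⟩))
    (G.disjoint_partitionEvent_of_pattern _ _ _ 0 2 (Or.inl ⟨by decide, by decide⟩))
    (G.disjoint_partitionEvent_of_pattern _ _ _ 0 1 (Or.inl ⟨by decide, by decide⟩))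

/-- `Y_d = P(vbd|c) + P(vcd|b) + P(vb|cd) + P(vc|bd)`. -/
theorem prob_Y_d (p : E → ℝ) (v b c d : V) :
    prob p (G.attachEvent v d b c ∩ G.sepEvent b c) =
      G.law4 p v b c d 2 + G.law4 p v b c d 5 + G.law4 p v b c d 3 + G.law4 p v b c d 6 := by
  rw [← G.rowsY_d]
  exact prob_union4 p
    (G.disjoint_partitionEvent_of_pattern _ _ _ 0 1 (Or.inl ⟨by decide, by decide⟩))
    (G.disjoint_partitionEvent_of_pattern _ _ _ 0 3 (Or.inl ⟨by decide, by decide⟩))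
    (G.disjoint_partitionEvent_of_pattern _ _ _ 0 1 (Or.inr ⟨by decide, by decide⟩))
    (G.disjoint_partitionEvent_of_pattern _ _ _ 0 3 (Or.inl ⟨by decide, by decide⟩))
    (G.disjoint_partitionEvent_of_pattern _ _ _ 0 3 (Or.inl ⟨by decide, by decide⟩))
    (G.disjoint_partitionEvent_of_pattern _ _ _ 0 1 (Or.inl ⟨by decide, by decide⟩))

end Prob

end MultiGraph

/-- **typer-2's `Lemma6Pendant` holds**: the three instances of `pendant_lemma6` on the rows of
`law4` (`x_i · Y_i ≤ R_i · top` for `i = b, c, d`). -/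
theorem Lemma6Pendant_holds : Lemma6Pendant := by
  intro V E _ _ G p hp v b c d _
  simp only [MultiGraph.law4]
  refine ⟨?_, ?_, ?_⟩
  · have h := G.pendant_lemma6 v b c d hp
    rw [← G.row0_eq_b, ← G.row3_eq, ← G.row4_eq] at h
    have hY := G.prob_Y_b p v b c d
    simp only [MultiGraph.law4] at hY
    rw [hY] at h
    exact h
  · have h := G.pendant_lemma6 v c b d hp
    rw [← G.row0_eq_c, ← G.row6_eq, ← G.row7_eq] at h
    have hY := G.prob_Y_c p v b c d
    simp only [MultiGraph.law4] at hY
    rw [hY] at h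
    exact h
  · have h := G.pendant_lemma6 v d b c hp
    rw [← G.row0_eq_d, ← G.row8_eq, ← G.row11_eq] at h
    have hY := G.prob_Y_d p v b c d
    simp only [MultiGraph.law4] at hY
    rw [hY] at h
    exact h

end PercRepro
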